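import Literature.MathematicalPhysics.QuantumFieldTheory.Balaban1983to89.Node00.OpsYOfLetters
import Literature.MathematicalPhysics.QuantumFieldTheory.Balaban1983to89.B9PinCarriersNonVacuity

/-!
# `Balaban1983to89.B9Cor35ComparisonsGAAtLetters` — [B9] Cor. 3.5 p. 407 at `U = 1` for `G(U)` (Theorem 3.3) AT THE OPERATOR LAYER READ FROM
# BAŁABAN'S LETTERS (`Node00.opsYOfLetters`): the five comparisons `hGA_e`, `hGA_h1`, `hGA_e4`, `hGA_h2`, `hGA_l2` of the N06 knit PROVED at the instance

B9 = T. Bałaban, *Propagators for lattice gauge theories in a background field*, Commun. Math. Phys. **99** (1985) 389–434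
[Balaban1985BackgroundPropagators]; [4] = B6 = T. Bałaban, *Propagators and renormalization transformations for lattice gauge theories. II*,
Commun. Math. Phys. **96** (1984) 223–250 [Balaban1984PropagatorsII].

statement-level skeleton of published theorems with citation tags; proofs where landed; nothing here is a claim about the Yang–Mills mass gap

THE PRINTED LOCI.  p. 399, Theorem 3.3: *"the operator G(U) (a = 1) satisfies the inequalities (3.42)–(3.47), with G′(U) replaced by G(U) and λ replaced by a
function J defined at bonds …"*; p. 407, proof of Corollary 3.5: *"There we have proved these theorems for operators with the external gauge field
configuration U = 1."*; p. 395: *"It coincides with Δ_a in (2.19) if U = 1"*; [4] Prop. 2.6 (2.136)–(2.140) p. 247 (the `U = 1` statements, r03's census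
reading `B6Prop26Census2136KLevelV1.kG`, NODE 00's `Node00.GU`).

THE POINT.  NODE 00 def-Y's `Node00/OpsYOfLetters.lean` (p464552) defines the operator layer `Node00.opsYOfLetters N θ M⋆ 𝔏 𝔈 : Node00.OpsY N θ M⋆` from a
letter interface `Node00.CovLettersY` carrying the printed `U = 1` clauses (`GA_one : G(1)(J ⊗ E) = (Gop J) ⊗ E`, `parB_one : U(Γ)(1) = 1`); its `G(U)` family is
the bond-sector reading `Node00.kernelFamilyB` (r03's `kG` formulas with `‖·‖`, covariant bond differences `cdB ∕ cdsB ∕ lapB` in physical units `c_f`, the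
transporter in the Hölder quotients, outer supremum over the closed unit ball of directions `E`).  THIS FILE proves the five `U = 1` comparison rows of the
Stage-11 certificate (`BalabanUVNodesN06AtRecord11CB10YZW.b9_main_of_up_view₁₁B10YZW_of_obligations`, binders :217–:226) AT THAT INSTANCE, for every
`𝔏`, `𝔈`:
* §1 the bond-sector covariant calculus AT `U = 1` ON PRODUCT-FORM LIFTS: `cdB i 1 μ (f ⊗ E) = (DV μ c_f f) ⊗ E`, `cdsB` ∕ `DVa`, `lapB` ∕ `LapV` (def-Y's
  `cdB_one` ∕ `cdsB_one` + r03's `DV_apply` ∕ `DVa_apply` ∕ `LapV`).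
* §2 the readers on lifts along a direction of the unit ball: `supInB ≤ supIn`, `holderQB (par ≡ 1) ≤ holderQ`, `l2OfY ≤ l2Of` (pointwise `‖J ⊗ E‖ ≤ |J|`).
* §3 for ANY bond-sector letter `O` with the printed clause `O 1 (J ⊗ E) = (Gop J) ⊗ E` and any transporter with `par 1 = 1`: every entry (3.42)–(3.46) of
  `kernelFamilyB i B cfg O par` at a configuration `U₁` with `cfg U₁ = 1` is `≤` r03's `kG i` — `kernelFamilyB_e_one_le` … `kernelFamilyB_l2_one_le`.
* §4 at the member: `GA_e_one_le` … `GA_l2_one_le` for `(operatorLayerYOfLetters 𝔸 G x 𝔏 𝔈).GA` against `Node00.GU x.toKIdx` (both summands), generic `𝔸`, `G`;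
  `GA_glob_inl` (the (3.47) reading is `0` on site arguments, `rfl`).
* §5 at the record: the binder shapes VERBATIM at `ops := opsYOfLetters N θ M⋆ 𝔏 𝔈` — `hGA_e_opsYOfLetters` … `hGA_l2_opsYOfLetters`, and `hnullGA_opsYOfLetters`
  (the (3.47) null on site arguments used by the knit's row-12 feed).

HONEST SCOPE.  Rows 4–8 are discharged AT THE LAYER OF LETTERS: what is used of [B9] is exactly def-Y's printed `U = 1` clauses (hypothesis fields of the
interface), the domination `‖J ⊗ E‖ ≤ |J|` on the unit ball, and the flat bond calculus; NOT the construction of Bałaban's `G(U) = Δ_a(U)⁻¹` over the member's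
domains (def-Y's successor item `lettersYOfRecord`); no estimate of print is asserted; count-neutral; N06 NOT discharged.  g0's `B9Cor35ComparisonsGA` pin
(`GAOfOps`, sphere-polarised, no transporter) remains the reading under which the rows are EQUALITIES; def-Y's ball reading is `≤` it at `U = 1`.  One finite
lattice programme; NOT continuum ∕ OS ∕ mass gap ∕ Clay.  No `def` ∕ `sorry` ∕ `axiom` ∕ `instance` ∕ `notation`.  Cell `pub-ymgap` (HUMAN RULING D-0062), Track A
node N06, seat `pub-ymgap-dag-n06-g` g2 (bundle F2 of dag-lead's N06-ASSIGNMENT v1), 2026-08-26.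
-/

noncomputable section

namespace Literature.MathematicalPhysics.QuantumFieldTheory.Balaban1983to89.B9Cor35ComparisonsGAAtLetters

open B9Eq39Adjoint (R R_one)
open B6SectAOperatorsV1 (BondIdx)
open B6GlobalChartV1 (PV domT blkV1)
open B6Ineq2142KLevelV1 (β)
open B6KLevelCensusIndexV1 (KIdx Adm)
open B6GradLegKLevelV1 (DV DV_apply)
open B6LapLegKLevelV1 (DVa DVa_apply LapV)
open B6Prop26Census2136KLevelV1 (Gop supIn holderQ l2Of kG)
open B9BackgroundsKLevelV1 (CfgV1 shiftsV1)
open B9PinMembersKLevelV1 (MemberY geo9Y bg9Y)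
open B9PinCarriersNonVacuity (supIn_nonneg holderQ_nonneg l2Of_nonneg GU_e_nonneg GU_h1_nonneg GU_e4_nonneg GU_h2_nonneg GU_l2_nonneg)
open B7Prop2SpecialUnitary (specialUnitaryUnits)
open Node00 (SiteY FBondY BlkY IBondY CfgY BallY liftY liftY_apply norm_liftY_le cdB cdsB lapB cdB_one cdsB_one supInB holderQB l2OfY
  BondOpY BondParY kernelFamilyB CovLettersY ExpLettersY operatorLayerYOfLetters LettersY ExpsY opsYOfLetters GA_e_inl GA_e4_inl GA_h2_inl iSup_ball_le
  KLoc KCut GU toKT Stage3Params)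
open scoped Matrix

variable {d ℓ : ℕ} {hd : 1 ≤ d + 1} {hL : Odd (ℓ + 1) ∧ 1 < ℓ + 1} {b₀ b₁ : ℝ} {Mstar : ℕ}
variable {𝔸 : Type} [NormedRing 𝔸] [NormedAlgebra ℂ 𝔸] [CompleteSpace 𝔸]

/-! ## §1 The bond-sector covariant calculus at `U = 1` on product-form lifts -/

section Calculus

variable (i : KIdx d ℓ hd hL b₀ b₁)

/-- **at `U = 1` the bond-sector covariant derivative of a lift is the lift of r03's forward difference**: `∇_{1,μ}(f ⊗ E) = (DV μ c_f f) ⊗ E`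
(p. 395 «coincides with Δ_a … if U = 1»; def-Y's `cdB_one`). [cite: Balaban1985BackgroundPropagators, (3.3) p.390 + p.395; Balaban1984PropagatorsII, (2.136) p.247] -/
theorem cdB_one_liftY (μ : Fin (d + 1)) (f : FBondY i → ℝ) (E : 𝔸) :
    cdB i (fun _ _ => 1) μ (liftY f E) = liftY (DV μ i.cf f) E := by
  funext b
  rw [cdB_one]
  simp only [liftY_apply]
  rw [DV_apply, ← sub_smul, smul_smul, ← Complex.ofReal_sub, ← Complex.ofReal_mul]
  rfl

/-- **at `U = 1` the bond-sector `∇*` of a lift is the lift of r03's backward difference**: `∇*_{1,μ}(f ⊗ E) = (DVa μ c_f f) ⊗ E` (def-Y's `cdsB_one`).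
[cite: Balaban1985BackgroundPropagators, (3.8) p.392 + p.395; Balaban1984PropagatorsII, (2.136) p.247] -/
theorem cdsB_one_liftY (μ : Fin (d + 1)) (f : FBondY i → ℝ) (E : 𝔸) :
    cdsB i (fun _ _ => 1) μ (liftY f E) = liftY (DVa μ i.cf f) E := by
  funext b
  rw [cdsB_one]
  simp only [liftY_apply]
  rw [DVa_apply, ← sub_smul, smul_smul, ← Complex.ofReal_sub, ← Complex.ofReal_mul]
  rfl

/-- **at `U = 1` the bond-sector covariant Laplacian of a lift is the lift of r03's `LapV c_f = Σ_μ DVa·DV`**: `Δ_1(f ⊗ E) = (LapV c_f f) ⊗ E`.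
[cite: Balaban1985BackgroundPropagators, (3.23) p.395; Balaban1984PropagatorsII, (2.136) p.247 («|(ΔGJ)(x)|»)] -/
theorem lapB_one_liftY (f : FBondY i → ℝ) (E : 𝔸) : lapB i (fun _ _ => 1) (liftY f E) = liftY (LapV i.cf f) E := by
  funext b
  show ∑ μ : Fin (d + 1), cdsB i (fun _ _ => 1) μ (cdB i (fun _ _ => 1) μ (liftY f E)) b = _
  simp only [cdB_one_liftY, cdsB_one_liftY, liftY_apply]
  rw [← Finset.sum_smul, ← Complex.ofReal_sum, LapV, LinearMap.sum_apply, Finset.sum_apply]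
  rfl

end Calculus

/-! ## §2 The readers on product-form lifts along a direction of the unit ball -/

section Readers

variable (i : KIdx d ℓ hd hL b₀ b₁)

/-- **`sup_{x ∈ Δ(y)} ‖(g ⊗ E)(x)‖ ≤ sup_{x ∈ Δ(y)} |g(x)|`** for `‖E‖ ≤ 1` (def-Y's `supInB` vs r03's `supIn`).
[cite: Balaban1985BackgroundPropagators, (3.42) p.397 + Cor. 3.5 p.407; Balaban1984PropagatorsII, (2.136) p.247] -/
theorem supInB_liftY_le (y : BlkY i) (g : FBondY i → ℝ) (E : BallY 𝔸) : supInB i y (liftY g (E : 𝔸)) ≤ supIn i y g := by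
  unfold supInB supIn
  refine Real.iSup_le (fun x => le_trans (norm_liftY_le g E x.1) ?_) (Real.iSup_nonneg fun _ => abs_nonneg _)
  exact le_ciSup (f := fun x : {x : FBondY i // blkV1 i.hN i.D x = y} => |g x.1|) (Set.finite_range _).bddAbove x

/-- **the transported Hölder quotient of `ζ·(g ⊗ E)` at `U = 1` is at most r03's Hölder quotient of `ζ·g`** for `‖E‖ ≤ 1`: with the transporter `≡ 1`
(`parB_one`), `‖ζ(x)(g ⊗ E)(x) − R(1)ζ(x′)(g ⊗ E)(x′)‖ = |ζ(x)g(x) − ζ(x′)g(x′)|·‖E‖` (def-Y's `holderQB` vs r03's `holderQ`).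
[cite: Balaban1985BackgroundPropagators, (3.40) p.397 + (3.43) p.398 + Cor. 3.5 p.407; Balaban1984PropagatorsII, (2.137) p.247] -/
theorem holderQB_one_liftY_le (α : ℝ) (ζ g : FBondY i → ℝ) (E : BallY 𝔸) :
    holderQB i (fun _ _ => 1) α ζ (liftY g (E : 𝔸)) ≤ holderQ i α ζ g := by
  unfold holderQB holderQ
  refine Real.iSup_le (fun q => ?_) (holderQ_nonneg i α ζ g)
  refine le_trans ?_ (le_ciSup (Set.finite_range _).bddAbove q)
  dsimp only
  split_ifs with hq
  · refine mul_le_mul_of_nonneg_left ?_ (Real.rpow_nonneg (mul_nonneg (Nat.cast_nonneg _) (inv_nonneg.2 (abs_nonneg _))) _)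
    rw [R_one, liftY_apply, liftY_apply, smul_smul, smul_smul, ← sub_smul, ← Complex.ofReal_mul, ← Complex.ofReal_mul,
      ← Complex.ofReal_sub]
    exact norm_liftY_le (fun _ : Unit => ζ q.1 * g q.1 - ζ q.2 * g q.2) E ()  -- `‖(r : ℂ)·E‖ ≤ |r|` (n06-f's `norm_real_smul_ball_le`)
  · exact le_rfl

/-- **the flat `L²` norm of `h·(g ⊗ E)` is at most r03's `‖h·g‖`** for `‖E‖ ≤ 1` (def-Y's `l2OfY` vs r03's `l2Of`).
[cite: Balaban1985BackgroundPropagators, (3.46) p.398 + Cor. 3.5 p.407; Balaban1984PropagatorsII, (2.140) p.247] -/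
theorem l2OfY_liftY_le {X : Type} [Fintype X] (h g : X → ℝ) (E : BallY 𝔸) : l2OfY h (liftY g (E : 𝔸)) ≤ l2Of h g := by
  unfold l2OfY l2Of
  refine Real.sqrt_le_sqrt (Finset.sum_le_sum fun x _ => ?_)
  rw [mul_pow, mul_pow]
  refine mul_le_mul_of_nonneg_left ?_ (sq_nonneg _)
  calc ‖liftY g (E : 𝔸) x‖ ^ 2 ≤ |g x| ^ 2 := pow_le_pow_left₀ (norm_nonneg _) (norm_liftY_le g E x) 2
    _ = g x ^ 2 := sq_abs _

/-- a supremum over a finite index of termwise-dominated reals is dominated (both sides over the same index; e.g. the directions `ν`).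
[cite: Balaban1984PropagatorsII, (2.136) p.247 (the sup over the direction), bookkeeping] -/
theorem iSup_fin_mono {ι : Type} [Finite ι] {u v : ι → ℝ} (h : ∀ k, u k ≤ v k) : (⨆ k, u k) ≤ ⨆ k, v k :=
  ciSup_mono (Set.finite_range _).bddAbove h

/-- entrywise domination of two 4-vectors of reals. [cite: Balaban1984PropagatorsII, (2.136) p.247 (the four entries), bookkeeping] -/
theorem vec4_le {s₀ s₁ s₂ s₃ t₀ t₁ t₂ t₃ : ℝ} (h₀ : s₀ ≤ t₀) (h₁ : s₁ ≤ t₁) (h₂ : s₂ ≤ t₂) (h₃ : s₃ ≤ t₃) (n : Fin 4) :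
    (![s₀, s₁, s₂, s₃] : Fin 4 → ℝ) n ≤ (![t₀, t₁, t₂, t₃] : Fin 4 → ℝ) n := by
  fin_cases n
  · exact h₀
  · exact h₁
  · exact h₂
  · exact h₃

/-- entrywise domination of two 6-vectors of reals. [cite: Balaban1984PropagatorsII, (2.140) p.247 (the six entries), bookkeeping] -/
theorem vec6_le {s₀ s₁ s₂ s₃ s₄ s₅ t₀ t₁ t₂ t₃ t₄ t₅ : ℝ} (h₀ : s₀ ≤ t₀) (h₁ : s₁ ≤ t₁) (h₂ : s₂ ≤ t₂) (h₃ : s₃ ≤ t₃) (h₄ : s₄ ≤ t₄)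
    (h₅ : s₅ ≤ t₅) (n : Fin 6) : (![s₀, s₁, s₂, s₃, s₄, s₅] : Fin 6 → ℝ) n ≤ (![t₀, t₁, t₂, t₃, t₄, t₅] : Fin 6 → ℝ) n := by
  fin_cases n
  · exact h₀
  · exact h₁
  · exact h₂
  · exact h₃
  · exact h₄
  · exact h₅

end Readers

/-! ## §3 Any bond-sector letter with the printed `U = 1` clause: the entries (3.42)–(3.46) of `kernelFamilyB` at `U = 1` are `≤` r03's `kG` -/

section BondLetter

variable (i : KIdx d ℓ hd hL b₀ b₁) (B : B9.Backgrounds) (cfg : B.Cfg → CfgY 𝔸 i) (O : BondOpY 𝔸 i) (par : BondParY 𝔸 i) (U₁ : B.Cfg)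
  (hU : cfg U₁ = fun _ _ => 1) (hO : ∀ (J : FBondY i → ℝ) (E : 𝔸), O (fun _ _ => 1) (liftY J E) = liftY (Gop i J) E)
  (hpar : ∀ s s', par (fun _ _ => 1) s s' = 1)
include hU hO

/-- **(3.42) for G(1) vs (2.136) for [4]'s G, AT THE LETTERS**: for a bond-sector letter `O` acting at `U = 1` on `J ⊗ E` as r03's `Gop` (the printed clause),
the four sup entries of def-Y's reading at a configuration read as `U ≡ 1` are `≤` r03's census entries `(kG i).e n J (β b)` — termwise `‖·‖ ≤ |·|` on the
unit ball, flat calculus at `U = 1`, then the sup over directions. [cite: Balaban1985BackgroundPropagators, Cor. 3.5 p.407 + (3.42) p.397; Balaban1984PropagatorsII, Prop. 2.6 (2.136) p.247] -/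
theorem kernelFamilyB_e_one_le (n : Fin 4) (J : FBondY i → ℝ) (b : IBondY i) :
    (kernelFamilyB i B cfg O par).e n U₁ (Sum.inr J) b ≤ (kG i).e n J (β i.hN i.D i.hk b) := by
  have hnn : 0 ≤ (kG i).e n J (β i.hN i.D i.hk b) := GU_e_nonneg i n (Sum.inr J) b
  simp only [kernelFamilyB, hU, hO, cdB_one_liftY, cdsB_one_liftY, lapB_one_liftY]
  refine iSup_ball_le (fun E => ?_) hnn
  simp only [kG, LinearMap.comp_apply]
  exact vec4_le (supInB_liftY_le i _ _ E) (iSup_fin_mono fun ν => supInB_liftY_le i _ _ E)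
    (iSup_fin_mono fun ν => supInB_liftY_le i _ _ E) (supInB_liftY_le i _ _ E) n

/-- **(3.44) for G(1) vs (2.138), AT THE LETTERS**: the entry `e4` of def-Y's reading at `U ≡ 1` is `≤` r03's `(kG i).e4`.
[cite: Balaban1985BackgroundPropagators, Cor. 3.5 p.407 + (3.44) p.398; Balaban1984PropagatorsII, Prop. 2.6 (2.138) p.247] -/
theorem kernelFamilyB_e4_one_le (J : FBondY i → ℝ) (b : IBondY i) :
    (kernelFamilyB i B cfg O par).e4 U₁ (Sum.inr J) b ≤ (kG i).e4 J (β i.hN i.D i.hk b) := by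
  have hnn : 0 ≤ (kG i).e4 J (β i.hN i.D i.hk b) := GU_e4_nonneg i (Sum.inr J) b
  simp only [kernelFamilyB, hU, hO, cdB_one_liftY, cdsB_one_liftY]
  refine iSup_ball_le (fun E => ?_) hnn
  simp only [kG, LinearMap.comp_apply]
  exact iSup_fin_mono fun ν => iSup_fin_mono fun μ => supInB_liftY_le i _ _ E

/-- **(3.46) for G(1) vs (2.140), AT THE LETTERS**: the six flat `L²` entries of def-Y's reading at `U ≡ 1` are `≤` r03's `(kG i).l2 n`.
[cite: Balaban1985BackgroundPropagators, Cor. 3.5 p.407 + (3.46) p.398; Balaban1984PropagatorsII, Prop. 2.6 (2.140) p.247] -/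
theorem kernelFamilyB_l2_one_le (n : Fin 6) (J : FBondY i → ℝ) (hh : FBondY i → ℝ) :
    (kernelFamilyB i B cfg O par).l2 n U₁ (Sum.inr J) (Sum.inr hh) ≤ (kG i).l2 n J hh := by
  have hnn : 0 ≤ (kG i).l2 n J hh := GU_l2_nonneg i n (Sum.inr J) (Sum.inr hh)
  simp only [kernelFamilyB, hU, hO, cdB_one_liftY, cdsB_one_liftY]
  refine iSup_ball_le (fun E => ?_) hnn
  simp only [kG, LinearMap.comp_apply]
  exact vec6_le (l2OfY_liftY_le _ _ E) (iSup_fin_mono fun ν => l2OfY_liftY_le _ _ E) (iSup_fin_mono fun ν => l2OfY_liftY_le _ _ E)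
    (iSup_fin_mono fun ν => iSup_fin_mono fun μ => l2OfY_liftY_le _ _ E)
    (iSup_fin_mono fun ν => iSup_fin_mono fun μ => l2OfY_liftY_le _ _ E)
    (iSup_fin_mono fun ν => iSup_fin_mono fun μ => l2OfY_liftY_le _ _ E) n

include hpar

/-- **(3.43) for G(1) vs (2.137), AT THE LETTERS**: with the transporter `≡ 1` at `U = 1` (the printed clause `parB_one`), the Hölder entry `h1` of def-Y's
reading at `U ≡ 1` is `≤` r03's `(kG i).h1`. [cite: Balaban1985BackgroundPropagators, Cor. 3.5 p.407 + (3.40), (3.43) pp.397–398; Balaban1984PropagatorsII, Prop. 2.6 (2.137) p.247] -/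
theorem kernelFamilyB_h1_one_le (J : FBondY i → ℝ) (α : ℝ) (z : FBondY i → ℝ) :
    (kernelFamilyB i B cfg O par).h1 U₁ (Sum.inr J) α (Sum.inr z) ≤ (kG i).h1 J α z := by
  have hnn : 0 ≤ (kG i).h1 J α z := GU_h1_nonneg i (Sum.inr J) α (Sum.inr z)
  have hpar' : par (fun _ _ => 1) = fun _ _ => 1 := funext fun s => funext fun s' => hpar s s'
  simp only [kernelFamilyB, hU, hO, cdB_one_liftY, cdsB_one_liftY, hpar']
  refine iSup_ball_le (fun E => ?_) hnn
  simp only [kG, LinearMap.comp_apply]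
  exact max_le_max (iSup_fin_mono fun ν => holderQB_one_liftY_le i α z _ E) (iSup_fin_mono fun ν => holderQB_one_liftY_le i α z _ E)

/-- **(3.45) for G(1) vs (2.139), AT THE LETTERS**: the Hölder entry `h2` of def-Y's reading at `U ≡ 1` is `≤` r03's `(kG i).h2`.
[cite: Balaban1985BackgroundPropagators, Cor. 3.5 p.407 + (3.40), (3.45) pp.397–398; Balaban1984PropagatorsII, Prop. 2.6 (2.139) p.247] -/
theorem kernelFamilyB_h2_one_le (J : FBondY i → ℝ) (α : ℝ) (z : FBondY i → ℝ) :
    (kernelFamilyB i B cfg O par).h2 U₁ (Sum.inr J) α (Sum.inr z) ≤ (kG i).h2 J α z := by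
  have hnn : 0 ≤ (kG i).h2 J α z := GU_h2_nonneg i (Sum.inr J) α (Sum.inr z)
  have hpar' : par (fun _ _ => 1) = fun _ _ => 1 := funext fun s => funext fun s' => hpar s s'
  simp only [kernelFamilyB, hU, hO, cdB_one_liftY, cdsB_one_liftY, hpar']
  refine iSup_ball_le (fun E => ?_) hnn
  simp only [kG, LinearMap.comp_apply]
  exact iSup_fin_mono fun ν => iSup_fin_mono fun μ => holderQB_one_liftY_le i α z _ E

end BondLetter

/-! ## §4 At the member: the layer's `G(U)` family at `U = 1` against NODE 00's `Node00.GU` (both summands) -/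

section Member

variable {G : Subgroup 𝔸ˣ} (x : MemberY d ℓ hd hL b₀ b₁ Mstar) (𝔏 : CovLettersY 𝔸 x) (𝔈 : ExpLettersY 𝔸 G x)

/-- **ROW 4 `hGA_e` AT THE MEMBER**: the (3.42) entries of the layer's `G(U)` family at `U ≡ 1` are `≤` NODE 00's reading `Node00.GU x.toKIdx` of [4] Prop. 2.6
(bond summand: §3 with def-Y's clauses `GA_one`; site summand: both `0`). [cite: Balaban1985BackgroundPropagators, Cor. 3.5 p.407 + (3.42) p.397; Balaban1984PropagatorsII, Prop. 2.6 (2.136) p.247] -/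
theorem GA_e_one_le (n : Fin 4) (lam : (geo9Y x).Loc) (y : (geo9Y x).Site) :
    (operatorLayerYOfLetters 𝔸 G x 𝔏 𝔈).GA.e n (bg9Y 𝔸 G x).one lam y ≤ (GU x.toKIdx).e n lam y := by
  cases lam with
  | inl f => exact (GA_e_inl x 𝔏 𝔈 n _ f y).trans_le (GU_e_nonneg _ n _ y)
  | inr J => exact kernelFamilyB_e_one_le x.toKIdx (bg9Y 𝔸 G x) (fun U => U) 𝔏.GA 𝔏.parB (bg9Y 𝔸 G x).one rfl 𝔏.GA_one n J y

/-- **ROW 5 `hGA_h1` AT THE MEMBER**: the (3.43) entry at `U ≡ 1` is `≤` NODE 00's reading ((2.137); transporter killed by `parB_one`; off-summand cases `0 ≤ 0`).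
[cite: Balaban1985BackgroundPropagators, Cor. 3.5 p.407 + (3.43) p.398; Balaban1984PropagatorsII, Prop. 2.6 (2.137) p.247] -/
theorem GA_h1_one_le (lam : (geo9Y x).Loc) (a : ℝ) (c : (geo9Y x).Cut) :
    (operatorLayerYOfLetters 𝔸 G x 𝔏 𝔈).GA.h1 (bg9Y 𝔸 G x).one lam a c ≤ (GU x.toKIdx).h1 lam a c := by
  cases lam with
  | inl f => cases c <;> exact le_rfl
  | inr J =>
    cases c with
    | inl z => exact le_rfl
    | inr z => exact kernelFamilyB_h1_one_le x.toKIdx (bg9Y 𝔸 G x) (fun U => U) 𝔏.GA 𝔏.parB (bg9Y 𝔸 G x).one rfl 𝔏.GA_one 𝔏.parB_one J a z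

/-- **ROW 6 `hGA_e4` AT THE MEMBER**: the (3.44) entry at `U ≡ 1` is `≤` NODE 00's reading ((2.138)).
[cite: Balaban1985BackgroundPropagators, Cor. 3.5 p.407 + (3.44) p.398; Balaban1984PropagatorsII, Prop. 2.6 (2.138) p.247] -/
theorem GA_e4_one_le (lam : (geo9Y x).Loc) (y : (geo9Y x).Site) :
    (operatorLayerYOfLetters 𝔸 G x 𝔏 𝔈).GA.e4 (bg9Y 𝔸 G x).one lam y ≤ (GU x.toKIdx).e4 lam y := by
  cases lam with
  | inl f => exact (GA_e4_inl x 𝔏 𝔈 _ f y).trans_le (GU_e4_nonneg _ _ y)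
  | inr J => exact kernelFamilyB_e4_one_le x.toKIdx (bg9Y 𝔸 G x) (fun U => U) 𝔏.GA 𝔏.parB (bg9Y 𝔸 G x).one rfl 𝔏.GA_one J y

/-- **ROW 7 `hGA_h2` AT THE MEMBER**: the (3.45) entry at `U ≡ 1` is `≤` NODE 00's reading ((2.139)).
[cite: Balaban1985BackgroundPropagators, Cor. 3.5 p.407 + (3.45) p.398; Balaban1984PropagatorsII, Prop. 2.6 (2.139) p.247] -/
theorem GA_h2_one_le (lam : (geo9Y x).Loc) (a : ℝ) (c : (geo9Y x).Cut) :
    (operatorLayerYOfLetters 𝔸 G x 𝔏 𝔈).GA.h2 (bg9Y 𝔸 G x).one lam a c ≤ (GU x.toKIdx).h2 lam a c := by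
  cases lam with
  | inl f => exact (GA_h2_inl x 𝔏 𝔈 _ f a c).trans_le (GU_h2_nonneg _ _ a c)
  | inr J =>
    cases c with
    | inl z => exact le_rfl
    | inr z => exact kernelFamilyB_h2_one_le x.toKIdx (bg9Y 𝔸 G x) (fun U => U) 𝔏.GA 𝔏.parB (bg9Y 𝔸 G x).one rfl 𝔏.GA_one 𝔏.parB_one J a z

/-- **ROW 8 `hGA_l2` AT THE MEMBER**: the six (3.46) entries at `U ≡ 1` are `≤` NODE 00's reading ((2.140)).
[cite: Balaban1985BackgroundPropagators, Cor. 3.5 p.407 + (3.46) p.398; Balaban1984PropagatorsII, Prop. 2.6 (2.140) p.247] -/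
theorem GA_l2_one_le (n : Fin 6) (lam : (geo9Y x).Loc) (hc : (geo9Y x).Cut) :
    (operatorLayerYOfLetters 𝔸 G x 𝔏 𝔈).GA.l2 n (bg9Y 𝔸 G x).one lam hc ≤ (GU x.toKIdx).l2 n lam hc := by
  cases lam with
  | inl f => cases hc <;> exact le_rfl
  | inr J =>
    cases hc with
    | inl z => exact le_rfl
    | inr z => exact kernelFamilyB_l2_one_le x.toKIdx (bg9Y 𝔸 G x) (fun U => U) 𝔏.GA 𝔏.parB (bg9Y 𝔸 G x).one rfl 𝔏.GA_one n J z

/-- OFF the bond summand the (3.47) reading `GA.glob` is `0` (site arguments), at every `U` and `γ`. [cite: Balaban1985BackgroundPropagators, (3.47) p.398, bookkeeping] -/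
theorem GA_glob_inl (n : Fin 4) (U : (bg9Y 𝔸 G x).Cfg) (f : SiteY x.toKIdx → ℝ) (γ : ℝ) :
    (operatorLayerYOfLetters 𝔸 G x 𝔏 𝔈).GA.glob n U (Sum.inl f) γ = 0 := rfl

end Member

/-! ## §5 At the record: the certificate's binders `hGA_e … hGA_l2` at `ops := opsYOfLetters N θ M⋆ 𝔏 𝔈`, verbatim -/

section Record

open scoped Matrix.Norms.L2Operator

variable (N : ℕ) (θ : Stage3Params) (Mstar : ℕ) (𝔏 : LettersY N θ Mstar) (𝔈 : ExpsY N θ Mstar)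

/-- ★ **ROW 4 `hGA_e` OF THE N06 CERTIFICATE AT def-Y's INSTANCE** `ops := opsYOfLetters N θ M⋆ 𝔏 𝔈`, for every letter family `𝔏` and expansion letters `𝔈`:
the (3.42) entries of `(ops x).GA` at `U ≡ 1` are `≤ (Node00.GU x.toKIdx).e` — the binder of `b9_main_of_up_view₁₁B10YZW_of_obligations` verbatim.
[cite: Balaban1985BackgroundPropagators, Cor. 3.5 p.407 + (3.42) p.397; Balaban1984PropagatorsII, Prop. 2.6 (2.136) p.247] -/
theorem hGA_e_opsYOfLetters :
    ∀ (x : MemberY θ.d₆ θ.ℓ₆ θ.hd' θ.hL' θ.b₀ θ.b₁ Mstar) (n : Fin 4) (lam : (geo9Y x).Loc) (y : (geo9Y x).Site),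
      ((opsYOfLetters N θ Mstar 𝔏 𝔈) x).GA.e n (bg9Y (Matrix (Fin N) (Fin N) ℂ) (specialUnitaryUnits (Fin N)) x).one lam y ≤
        (Node00.GU x.toKIdx).e n lam y :=
  fun x n lam y => GA_e_one_le x (𝔏 x) (𝔈 x) n lam y

/-- ★ **ROW 5 `hGA_h1` AT def-Y's INSTANCE**: the (3.43) entry at `U ≡ 1` is `≤ (Node00.GU x.toKIdx).h1`, binder shape verbatim.
[cite: Balaban1985BackgroundPropagators, Cor. 3.5 p.407 + (3.43) p.398; Balaban1984PropagatorsII, Prop. 2.6 (2.137) p.247] -/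
theorem hGA_h1_opsYOfLetters :
    ∀ (x : MemberY θ.d₆ θ.ℓ₆ θ.hd' θ.hL' θ.b₀ θ.b₁ Mstar) (lam : (geo9Y x).Loc) (b : ℝ) (c : (geo9Y x).Cut),
      ((opsYOfLetters N θ Mstar 𝔏 𝔈) x).GA.h1 (bg9Y (Matrix (Fin N) (Fin N) ℂ) (specialUnitaryUnits (Fin N)) x).one lam b c ≤
        (Node00.GU x.toKIdx).h1 lam b c :=
  fun x lam b c => GA_h1_one_le x (𝔏 x) (𝔈 x) lam b c

/-- ★ **ROW 6 `hGA_e4` AT def-Y's INSTANCE**: the (3.44) entry at `U ≡ 1` is `≤ (Node00.GU x.toKIdx).e4`, binder shape verbatim.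
[cite: Balaban1985BackgroundPropagators, Cor. 3.5 p.407 + (3.44) p.398; Balaban1984PropagatorsII, Prop. 2.6 (2.138) p.247] -/
theorem hGA_e4_opsYOfLetters :
    ∀ (x : MemberY θ.d₆ θ.ℓ₆ θ.hd' θ.hL' θ.b₀ θ.b₁ Mstar) (lam : (geo9Y x).Loc) (y : (geo9Y x).Site),
      ((opsYOfLetters N θ Mstar 𝔏 𝔈) x).GA.e4 (bg9Y (Matrix (Fin N) (Fin N) ℂ) (specialUnitaryUnits (Fin N)) x).one lam y ≤
        (Node00.GU x.toKIdx).e4 lam y :=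
  fun x lam y => GA_e4_one_le x (𝔏 x) (𝔈 x) lam y

/-- ★ **ROW 7 `hGA_h2` AT def-Y's INSTANCE**: the (3.45) entry at `U ≡ 1` is `≤ (Node00.GU x.toKIdx).h2`, binder shape verbatim.
[cite: Balaban1985BackgroundPropagators, Cor. 3.5 p.407 + (3.45) p.398; Balaban1984PropagatorsII, Prop. 2.6 (2.139) p.247] -/
theorem hGA_h2_opsYOfLetters :
    ∀ (x : MemberY θ.d₆ θ.ℓ₆ θ.hd' θ.hL' θ.b₀ θ.b₁ Mstar) (lam : (geo9Y x).Loc) (b : ℝ) (c : (geo9Y x).Cut),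
      ((opsYOfLetters N θ Mstar 𝔏 𝔈) x).GA.h2 (bg9Y (Matrix (Fin N) (Fin N) ℂ) (specialUnitaryUnits (Fin N)) x).one lam b c ≤
        (Node00.GU x.toKIdx).h2 lam b c :=
  fun x lam b c => GA_h2_one_le x (𝔏 x) (𝔈 x) lam b c

/-- ★ **ROW 8 `hGA_l2` AT def-Y's INSTANCE**: the six (3.46) entries at `U ≡ 1` are `≤ (Node00.GU x.toKIdx).l2 n`, binder shape verbatim.
[cite: Balaban1985BackgroundPropagators, Cor. 3.5 p.407 + (3.46) p.398; Balaban1984PropagatorsII, Prop. 2.6 (2.140) p.247] -/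
theorem hGA_l2_opsYOfLetters :
    ∀ (x : MemberY θ.d₆ θ.ℓ₆ θ.hd' θ.hL' θ.b₀ θ.b₁ Mstar) (n : Fin 6) (lam : (geo9Y x).Loc) (hc : (geo9Y x).Cut),
      ((opsYOfLetters N θ Mstar 𝔏 𝔈) x).GA.l2 n (bg9Y (Matrix (Fin N) (Fin N) ℂ) (specialUnitaryUnits (Fin N)) x).one lam hc ≤
        (Node00.GU x.toKIdx).l2 n lam hc :=
  fun x n lam hc => GA_l2_one_le x (𝔏 x) (𝔈 x) n lam hc

/-- **the (3.47) null of `G(1)` on SITE arguments at the instance** (the knit's `hnullGA`, feeding n06-h's `hGA_of_globOn_of_null` for row 12): `(ops x).GA.glob`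
reads `0` off the bond summand. [cite: Balaban1985BackgroundPropagators, (3.47) p.398, bookkeeping] -/
theorem hnullGA_opsYOfLetters :
    ∀ (x : MemberY θ.d₆ θ.ℓ₆ θ.hd' θ.hL' θ.b₀ θ.b₁ Mstar) (n : Fin 4) (lam : (geo9Y x).Loc) (γ : ℝ), ¬ (lam.isRight = true) →
      ((opsYOfLetters N θ Mstar 𝔏 𝔈) x).GA.glob n (bg9Y (Matrix (Fin N) (Fin N) ℂ) (specialUnitaryUnits (Fin N)) x).one lam γ ≤ 0 := by
  intro x n lam γ hlam
  cases lam with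
  | inl f => exact (GA_glob_inl x (𝔏 x) (𝔈 x) n _ f γ).le
  | inr J => exact absurd rfl hlam

end Record

end Literature.MathematicalPhysics.QuantumFieldTheory.Balaban1983to89.B9Cor35ComparisonsGAAtLetters

end
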